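import Summits.AtomisticToContinuum.FouriersLaw.Theorems.BondHeatUncertaintySubdiffusiveBondHeatJunctionRatioTemperedPairing
import Summits.AtomisticToContinuum.FouriersLaw.Theorems.BondHeatUncertaintySubdiffusiveBondHeatJunctionRatioBracketCalculus

/-!
# `JunctionRatioWeakResponse` — file 24a: the WEAK LINEARISED STEADY-STATE EQUATION [WL] of the response density
# (cell `decomp-a2c`, lens-1 «grading / quantitative ladder», gen 65; beneath 19b `…JunctionRatioFirstBondBracket`, target 11071)

The g64 weak-form skeleton of the bracket identity [BI] `FirstBondBracket` reads [BI] ⟸ [EXT] ∧ [WL] ∧ [OPS] ∧ [GIBBS] ∧ [LINK];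
[OPS] (22a/22b) and [GIBBS] = (G1a) (23b) ∧ (G1b) (23d) are proved.  This file proves the one remaining PHYSICS input,
the weak linearised stationarity equation of the first-order response density `h` (`IsResponseDensityAt`, file 19):

* `generator_tilt` (§A, any chain, pointwise): `L_{T_L,T_R} f = L_{T,T} f + γ·∑_i ((T_L − T)𝟙_{i=0} + (T_R − T)𝟙_{i=N−1}) ∂²_{p_i} f`
  — the generator is affine in the bath temperatures; `sum_bath_tilt_eq` collapses the sum to the two bath sites (`N ≥ 1`).
* `integral_generator_mul_responseDensity_eq_tilt` (§C, TILT FORM, `N ≥ 1`, `ω₂, lam, β, γ, T > 0`): for every `F ∈ C_c^∞`,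
  `∫ (L_{T,T}F)·h dμ₀ = −(γ/2)·(∫ ∂²_{p_0}F dμ₀ − ∫ ∂²_{p_{N−1}}F dμ₀)`, `μ₀ = gibbsMeasure N T`.
  PROOF: steady states `μ_δ` at `(T + δ/2, T − δ/2)` exist (`exists_canonical_response`); `0 = ∫ L_δ F dμ_δ
  = ∫ L_T F dμ_δ + (γδ/2)∫ D dμ_δ` with `D = ∂²_{p_0}F − ∂²_{p_{N−1}}F`; expand both integrals to first order in `δ` with the
  response density (`∫ L_T F dμ₀ = 0` by `pinnedChain_isSteadyState_gibbsMeasure`), divide by `δ` and let `δ ↓ 0` (an `ε/(1+γ)` argument).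
* `integral_partialP_partialP_gibbsMeasure_eq` (§B): the measure form `∫ ∂²_{p_k}F dμ₀ = T⁻²(∫ p_k²F dμ₀ − T∫F dμ₀)` of the 23a bath identity.
* `integral_generator_mul_responseDensity_eq` (§C, SOURCE FORM = [WL]): `∫ (L_{T,T}F)·h dμ₀ = −(γ/(2T²))·∫ (p_0² − p²_{N−1})·F dμ₀`
  for every `F ∈ C_c^∞` — i.e. `L_{T,T}^† h = −(γ/2T²)(p_0² − p²_{N−1})` weakly: the linearised stationarity equation with its
  antisymmetric two-bath source, from the DEFINITION of the response density alone (no regularity input).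

Remaining beneath [BI] after this file: [EXT] (extension of [WL] and of the tap-score relation from `C_c^∞` to the tempered `C²`
class, by a Hamiltonian cut-off `φ(H/R)` — `X_H H = 0` makes `L_T φ(H/R)` a pure bath term) and [LINK] ⟸ [UM] (`τ_i = ∫ p_i² h dμ₀` from
uniform steady-state moments).  Complete proofs; standard axioms; imports only the tree files 23a `…TemperedPairing` and 22a `…BracketCalculus`.
-/

noncomputable section

open MeasureTheory Filter Topology Set
open scoped BigOperators

namespace Summit.AtomisticToContinuum.FouriersLaw.Theorems.SubdiffusiveBondHeat

namespace EscapeGrading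

open Literature.MathematicalPhysics.KineticTheory.HeatConduction
open Summit.AtomisticToContinuum.FouriersLaw.Theorems.SubdiffusiveBondHeat.JunctionDefectGrading

variable {ω₂ lam β γ : ℝ} {N : ℕ}

/-! ## A. The generator is affine in the bath temperatures -/

/-- **Temperature tilt of the generator** (pointwise, any chain `P`, any `f`):
`L_{T_L,T_R} f x = L_{T,T} f x + γ·∑_i ((T_L − T)·𝟙_{i=0} + (T_R − T)·𝟙_{i=N−1})·∂²_{p_i} f x`. -/
theorem generator_tilt (P : OscillatorChain) (N : ℕ) (T T_L T_R : ℝ) (f : PhaseSpace N → ℝ)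
    (x : PhaseSpace N) :
    P.generator N T_L T_R f x = P.generator N T T f x + P.γ * ∑ i : Fin N,
      ((if i.val = 0 then (T_L - T) * partialP i (partialP i f) x else 0) +
        (if i.val = N - 1 then (T_R - T) * partialP i (partialP i f) x else 0)) := by
  have key : ∀ i : Fin N,
      ((if i.val = 0 then T_L * partialP i (partialP i f) x - x.2 i * partialP i f x else 0) +
          (if i.val = N - 1 then T_R * partialP i (partialP i f) x - x.2 i * partialP i f x else 0)) =
        ((if i.val = 0 then T * partialP i (partialP i f) x - x.2 i * partialP i f x else 0) +
            (if i.val = N - 1 then T * partialP i (partialP i f) x - x.2 i * partialP i f x else 0)) +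
          ((if i.val = 0 then (T_L - T) * partialP i (partialP i f) x else 0) +
            (if i.val = N - 1 then (T_R - T) * partialP i (partialP i f) x else 0)) := by
    intro i
    split_ifs <;> ring
  simp only [OscillatorChain.generator]
  simp only [key]
  simp only [Finset.sum_add_distrib]
  ring

/-- Collapse of the bath-indexed tilt sum to the two bath sites (`N ≥ 1`; for `N = 1` both sites coincide). -/
theorem sum_bath_tilt_eq (hN : 1 ≤ N) (a b : ℝ) (A : Fin N → ℝ) :
    ∑ i : Fin N, ((if i.val = 0 then a * A i else 0) + (if i.val = N - 1 then b * A i else 0)) =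
      a * A ⟨0, by omega⟩ + b * A ⟨N - 1, by omega⟩ := by
  rw [Finset.sum_add_distrib]
  congr 1
  · rw [Finset.sum_eq_single ⟨0, by omega⟩ (fun i _ hi => if_neg fun h => hi (Fin.ext h))
      (fun h => absurd (Finset.mem_univ _) h), if_pos rfl]
  · rw [Finset.sum_eq_single ⟨N - 1, by omega⟩ (fun i _ hi => if_neg fun h => hi (Fin.ext h))
      (fun h => absurd (Finset.mem_univ _) h), if_pos rfl]

/-- The pinned chain between baths at `(T + δ/2, T − δ/2)`: `L_δ F = L_T F + γ(δ/2)·(∂²_{p_0}F − ∂²_{p_{N−1}}F)` (`N ≥ 1`). -/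
theorem pinnedChain_generator_tilt (hN : 1 ≤ N) (T δ : ℝ) (F : PhaseSpace N → ℝ) (x : PhaseSpace N) :
    (pinnedChain ω₂ lam β γ).generator N (T + δ / 2) (T - δ / 2) F x =
      (pinnedChain ω₂ lam β γ).generator N T T F x + γ * (δ / 2) *
        (partialP ⟨0, by omega⟩ (partialP ⟨0, by omega⟩ F) x -
          partialP ⟨N - 1, by omega⟩ (partialP ⟨N - 1, by omega⟩ F) x) := by
  rw [generator_tilt (pinnedChain ω₂ lam β γ) N T (T + δ / 2) (T - δ / 2) F x,
    sum_bath_tilt_eq hN (T + δ / 2 - T) (T - δ / 2 - T) (fun i => partialP i (partialP i F) x)]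
  have hγP : (pinnedChain ω₂ lam β γ).γ = γ := rfl
  rw [hγP]
  ring

/-! ## B. Compactly supported test functions are tempered; the measure form of the bath identity -/

/-- A continuous compactly supported function is tempered (it is bounded). -/
theorem IsTempered.of_hasCompactSupport {F : PhaseSpace N → ℝ} (hFc : Continuous F)
    (hK : HasCompactSupport F) : IsTempered ω₂ lam β γ N F := by
  obtain ⟨C, hC⟩ := hFc.bounded_above_of_compact_support hK
  exact IsTempered.of_bounded fun x => by simpa [Real.norm_eq_abs] using hC x

/-- **Bath identity, measure form.** For `F ∈ C²` with `F, ∂_{p_k}F, ∂²_{p_k}F` tempered and `T > 0`: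
`∫ ∂²_{p_k}F dμ₀ = T⁻²·(∫ p_k² F dμ₀ − T·∫ F dμ₀)` (`μ₀ = gibbsMeasure N T`; 23a `integral_partialP_partialP_mul_gibbsDensity_eq`). -/
theorem integral_partialP_partialP_gibbsMeasure_eq (hω : 0 < ω₂) (hl : 0 ≤ lam) (hβ : 0 ≤ β) (γ : ℝ)
    {T : ℝ} (hT : 0 < T) (k : Fin N) {F : PhaseSpace N → ℝ} (hF2 : ContDiff ℝ 2 F)
    (hF : IsTempered ω₂ lam β γ N F) (hF' : IsTempered ω₂ lam β γ N (partialP k F))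
    (hF'' : IsTempered ω₂ lam β γ N (partialP k (partialP k F))) :
    ∫ x, partialP k (partialP k F) x ∂(pinnedChain ω₂ lam β γ).gibbsMeasure N T =
      1 / T ^ 2 * ((∫ x, x.2 k ^ 2 * F x ∂(pinnedChain ω₂ lam β γ).gibbsMeasure N T) -
        T * ∫ x, F x ∂(pinnedChain ω₂ lam β γ).gibbsMeasure N T) := by
  have e := integral_partialP_partialP_mul_gibbsDensity_eq hω hl hβ γ hT k hF2 hF hF' hF''
  have hT2 : T ^ 2 ≠ 0 := by positivity
  have e' : ∫ x, partialP k (partialP k F) x * (pinnedChain ω₂ lam β γ).gibbsDensity N T x =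
      ((∫ x, x.2 k ^ 2 * F x * (pinnedChain ω₂ lam β γ).gibbsDensity N T x) -
        T * ∫ x, F x * (pinnedChain ω₂ lam β γ).gibbsDensity N T x) / T ^ 2 := by
    rw [← e]; field_simp
  simp only [OscillatorChain.integral_gibbsMeasure]
  rw [e']
  field_simp

/-! ## C. The weak linearised steady-state equation [WL] -/

/-- **[WL], tilt form.** For the pinned anharmonic chain (`ω₂, lam, β, γ, T > 0`, `N ≥ 1`), every response density `h` of the steady
states at `(T + δ/2, T − δ/2)` and every `F ∈ C_c^∞`:
`∫ (L_{T,T}F)·h dμ₀ = −(γ/2)·(∫ ∂²_{p_0}F dμ₀ − ∫ ∂²_{p_{N−1}}F dμ₀)`. -/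
theorem integral_generator_mul_responseDensity_eq_tilt (hω : 0 < ω₂) (hl : 0 < lam) (hβ : 0 < β)
    (hγ : 0 < γ) {T : ℝ} (hT : 0 < T) (hN : 1 ≤ N) {h : PhaseSpace N → ℝ}
    (hh : IsResponseDensityAt ω₂ lam β γ T N h) {F : PhaseSpace N → ℝ}
    (hF : ContDiff ℝ ((⊤ : ℕ∞) : WithTop ℕ∞) F) (hFc : HasCompactSupport F) :
    ∫ x, (pinnedChain ω₂ lam β γ).generator N T T F x * h x
        ∂(pinnedChain ω₂ lam β γ).gibbsMeasure N T =
      -(γ / 2) * ((∫ x, partialP ⟨0, by omega⟩ (partialP ⟨0, by omega⟩ F) x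
          ∂(pinnedChain ω₂ lam β γ).gibbsMeasure N T) -
        ∫ x, partialP ⟨N - 1, by omega⟩ (partialP ⟨N - 1, by omega⟩ F) x
          ∂(pinnedChain ω₂ lam β γ).gibbsMeasure N T) := by
  have htop1 : ((⊤ : ℕ∞) : WithTop ℕ∞) + 1 ≤ ((⊤ : ℕ∞) : WithTop ℕ∞) := by exact_mod_cast le_top
  have htop2 : ((⊤ : ℕ∞) : WithTop ℕ∞) + 2 ≤ ((⊤ : ℕ∞) : WithTop ℕ∞) :=
    calc ((⊤ : ℕ∞) : WithTop ℕ∞) + 2 = (⊤ : ℕ∞) + 1 + 1 := by rw [add_assoc, one_add_one_eq_two]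
      _ ≤ (⊤ : ℕ∞) + 1 := add_le_add_right htop1 1
      _ ≤ (⊤ : ℕ∞) := htop1
  have h1top : (1 : WithTop ℕ∞) ≤ ((⊤ : ℕ∞) : WithTop ℕ∞) := by exact_mod_cast le_top
  have h2top : (2 : WithTop ℕ∞) ≤ ((⊤ : ℕ∞) : WithTop ℕ∞) := le_trans le_add_self htop2
  have h0top : ((⊤ : ℕ∞) : WithTop ℕ∞) ≠ 0 := (lt_of_lt_of_le zero_lt_one h1top).ne'
  -- `G := L_T F` and `D := ∂²_{p_0}F − ∂²_{p_{N−1}}F` are smooth and compactly supported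
  set G : PhaseSpace N → ℝ := (pinnedChain ω₂ lam β γ).generator N T T F with hG
  set D : PhaseSpace N → ℝ := fun x =>
    partialP ⟨0, by omega⟩ (partialP ⟨0, by omega⟩ F) x -
      partialP ⟨N - 1, by omega⟩ (partialP ⟨N - 1, by omega⟩ F) x with hD
  have hFd : Differentiable ℝ F := hF.differentiable h0top
  have hd : ∀ k : Fin N, ContDiff ℝ ((⊤ : ℕ∞) : WithTop ℕ∞) (partialP k F) := fun k =>
    contDiff_partialP hF htop1 k
  have hdd : ∀ k : Fin N, ContDiff ℝ ((⊤ : ℕ∞) : WithTop ℕ∞) (partialP k (partialP k F)) := fun k =>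
    contDiff_partialP (hd k) htop1 k
  have hdc : ∀ k : Fin N, HasCompactSupport (partialP k F) := fun k =>
    hasCompactSupport_partialP hFd hFc k
  have hddc : ∀ k : Fin N, HasCompactSupport (partialP k (partialP k F)) := fun k =>
    hasCompactSupport_partialP ((hd k).differentiable h0top) (hdc k) k
  have hGs : ContDiff ℝ ((⊤ : ℕ∞) : WithTop ℕ∞) G :=
    contDiff_generator_of_contDiff (pinnedChain ω₂ lam β γ) (pinnedChain_contDiff_U ω₂ lam β γ)
      (pinnedChain_contDiff_V ω₂ lam β γ) T T hF htop2
  have hGc : HasCompactSupport G :=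
    (pinnedChain ω₂ lam β γ).hasCompactSupport_generator N T T (hF.of_le h2top) hFc
  have hDs : ContDiff ℝ ((⊤ : ℕ∞) : WithTop ℕ∞) D := (hdd _).sub (hdd _)
  have hDc : HasCompactSupport D := (hddc _).sub (hddc _)
  -- Gibbs side: `μ₀` is a probability measure and a steady state at `(T, T)`
  haveI hμ₀P : IsProbabilityMeasure ((pinnedChain ω₂ lam β γ).gibbsMeasure N T) :=
    pinnedChain_isProbabilityMeasure_gibbsMeasure hω hl.le hβ.le γ N hT
  have hG0 : ∫ x, G x ∂(pinnedChain ω₂ lam β γ).gibbsMeasure N T = 0 :=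
    (pinnedChain_isSteadyState_gibbsMeasure hω hl.le hβ.le γ N hT).2.1 F hF hFc
  have hZ : ∫ x, D x ∂(pinnedChain ω₂ lam β γ).gibbsMeasure N T =
      (∫ x, partialP ⟨0, by omega⟩ (partialP ⟨0, by omega⟩ F) x
          ∂(pinnedChain ω₂ lam β γ).gibbsMeasure N T) -
        ∫ x, partialP ⟨N - 1, by omega⟩ (partialP ⟨N - 1, by omega⟩ F) x
          ∂(pinnedChain ω₂ lam β γ).gibbsMeasure N T :=
    integral_sub ((hdd _).continuous.integrable_of_hasCompactSupport (hddc _))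
      ((hdd _).continuous.integrable_of_hasCompactSupport (hddc _))
  rw [← hZ]
  -- steady states at `(T + δ/2, T − δ/2)` exist
  obtain ⟨μf, hμf, -⟩ := exists_canonical_response hω hl hβ hγ hT
  -- it suffices to bound `|X + (γ/2)·Z|` by every `ε > 0`
  suffices key : ∀ ε : ℝ, 0 < ε →
      |(∫ x, G x * h x ∂(pinnedChain ω₂ lam β γ).gibbsMeasure N T) +
          γ / 2 * ∫ x, D x ∂(pinnedChain ω₂ lam β γ).gibbsMeasure N T| ≤ ε by
    have h0 : |(∫ x, G x * h x ∂(pinnedChain ω₂ lam β γ).gibbsMeasure N T) +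
        γ / 2 * ∫ x, D x ∂(pinnedChain ω₂ lam β γ).gibbsMeasure N T| ≤ 0 :=
      le_of_forall_pos_le_add fun ε hε => by rw [zero_add]; exact key ε hε
    have h1 := abs_nonpos_iff.mp h0
    linarith
  intro ε hε
  -- the response density at `G` and at `D`, with accuracy `ε' = ε/(1+γ)`
  set ε' : ℝ := ε / (1 + γ) with hε'
  have hε'pos : 0 < ε' := div_pos hε (by linarith)
  have hεε' : ε' * (1 + γ) = ε := by rw [hε']; field_simp
  obtain ⟨δ₁, hδ₁, H1⟩ := hh.2 G hGs hGc ε' hε'pos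
  obtain ⟨δ₂, hδ₂, H2⟩ := hh.2 D hDs hDc ε' hε'pos
  -- a small `δ`: below `δ₁, δ₂, 1, T` and `ε'/(|Y|+1)`, `Y = ∫ D·h dμ₀`
  have hY1 : 0 < |∫ x, D x * h x ∂(pinnedChain ω₂ lam β γ).gibbsMeasure N T| + 1 := by positivity
  have hq : 0 < ε' / (|∫ x, D x * h x ∂(pinnedChain ω₂ lam β γ).gibbsMeasure N T| + 1) :=
    div_pos hε'pos hY1
  set m : ℝ := min (min δ₁ δ₂) (min 1 (min T
    (ε' / (|∫ x, D x * h x ∂(pinnedChain ω₂ lam β γ).gibbsMeasure N T| + 1)))) with hm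
  have hmpos : 0 < m := lt_min (lt_min hδ₁ hδ₂) (lt_min one_pos (lt_min hT hq))
  set δ : ℝ := m / 2 with hδdef
  have hδ : 0 < δ := by positivity
  have hδm : δ < m := by rw [hδdef]; linarith
  have hδlt1 : δ < δ₁ := lt_of_lt_of_le hδm ((min_le_left _ _).trans (min_le_left _ _))
  have hδlt2 : δ < δ₂ := lt_of_lt_of_le hδm ((min_le_left _ _).trans (min_le_right _ _))
  have hδone : δ ≤ 1 := hδm.le.trans ((min_le_right _ _).trans (min_le_left _ _))
  have hδT : δ < T :=
    lt_of_lt_of_le hδm ((min_le_right _ _).trans ((min_le_right _ _).trans (min_le_left _ _)))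
  have hδY : δ ≤ ε' / (|∫ x, D x * h x ∂(pinnedChain ω₂ lam β γ).gibbsMeasure N T| + 1) :=
    hδm.le.trans ((min_le_right _ _).trans ((min_le_right _ _).trans (min_le_right _ _)))
  have hδY' : δ * |∫ x, D x * h x ∂(pinnedChain ω₂ lam β γ).gibbsMeasure N T| ≤ ε' := by
    have h1 := (le_div_iff₀ hY1).1 hδY
    have h2 : δ * (|∫ x, D x * h x ∂(pinnedChain ω₂ lam β γ).gibbsMeasure N T| + 1) =
        δ * |∫ x, D x * h x ∂(pinnedChain ω₂ lam β γ).gibbsMeasure N T| + δ := by ring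
    linarith
  -- a steady state at `(T + δ/2, T − δ/2)` and its stationarity equation tested on `F`
  have hTL : 0 < T + δ / 2 := by linarith
  have hTR : 0 < T - δ / 2 := by linarith
  set μ := μf N (T + δ / 2) (T - δ / 2) with hμdef
  have hμ : (pinnedChain ω₂ lam β γ).IsSteadyState N (T + δ / 2) (T - δ / 2) μ := hμf N _ _ hTL hTR
  haveI : IsProbabilityMeasure μ := hμ.1
  have hGi : Integrable G μ := hGs.continuous.integrable_of_hasCompactSupport hGc
  have hDi : Integrable D μ := hDs.continuous.integrable_of_hasCompactSupport hDc
  have hpt : ∀ x, (pinnedChain ω₂ lam β γ).generator N (T + δ / 2) (T - δ / 2) F x =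
      G x + γ * (δ / 2) * D x := fun x => by
    rw [pinnedChain_generator_tilt hN T δ F x]
  have E0 := hμ.2.1 F hF hFc
  simp_rw [hpt] at E0
  rw [integral_add hGi (hDi.const_mul _), integral_const_mul] at E0
  -- first-order expansions of `∫ G dμ` and `∫ D dμ`
  have R1 := H1 δ hδ hδlt1 μ hμ
  have R2 := H2 δ hδ hδlt2 μ hμ
  rw [hG0] at R1
  -- algebra: `δ·(X + (γ/2)Z) = −(∫G dμ − δX) − γ(δ/2)(∫D dμ − Z − δY) − γ(δ²/2)Y`
  have e1 : δ * ((∫ x, G x * h x ∂(pinnedChain ω₂ lam β γ).gibbsMeasure N T) +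
        γ / 2 * ∫ x, D x ∂(pinnedChain ω₂ lam β γ).gibbsMeasure N T) =
      -((∫ x, G x ∂μ) - 0 - δ * ∫ x, G x * h x ∂(pinnedChain ω₂ lam β γ).gibbsMeasure N T) -
        γ * (δ / 2) * ((∫ x, D x ∂μ) - (∫ x, D x ∂(pinnedChain ω₂ lam β γ).gibbsMeasure N T) -
          δ * ∫ x, D x * h x ∂(pinnedChain ω₂ lam β γ).gibbsMeasure N T) -
        γ * (δ ^ 2 / 2) * ∫ x, D x * h x ∂(pinnedChain ω₂ lam β γ).gibbsMeasure N T := by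
    linear_combination E0
  have e2 : δ * |(∫ x, G x * h x ∂(pinnedChain ω₂ lam β γ).gibbsMeasure N T) +
        γ / 2 * ∫ x, D x ∂(pinnedChain ω₂ lam β γ).gibbsMeasure N T| ≤
      δ * ε' + γ * (δ / 2) * (δ * ε') +
        γ * (δ ^ 2 / 2) * |∫ x, D x * h x ∂(pinnedChain ω₂ lam β γ).gibbsMeasure N T| := by
    have habs : δ * |(∫ x, G x * h x ∂(pinnedChain ω₂ lam β γ).gibbsMeasure N T) +
          γ / 2 * ∫ x, D x ∂(pinnedChain ω₂ lam β γ).gibbsMeasure N T| =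
        |δ * ((∫ x, G x * h x ∂(pinnedChain ω₂ lam β γ).gibbsMeasure N T) +
          γ / 2 * ∫ x, D x ∂(pinnedChain ω₂ lam β γ).gibbsMeasure N T)| := by
      rw [abs_mul, abs_of_pos hδ]
    rw [habs, e1]
    have hc1 : 0 < γ * (δ / 2) := by positivity
    have hc2 : 0 < γ * (δ ^ 2 / 2) := by positivity
    calc |-((∫ x, G x ∂μ) - 0 - δ * ∫ x, G x * h x ∂(pinnedChain ω₂ lam β γ).gibbsMeasure N T) -
            γ * (δ / 2) * ((∫ x, D x ∂μ) - (∫ x, D x ∂(pinnedChain ω₂ lam β γ).gibbsMeasure N T) -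
              δ * ∫ x, D x * h x ∂(pinnedChain ω₂ lam β γ).gibbsMeasure N T) -
            γ * (δ ^ 2 / 2) * ∫ x, D x * h x ∂(pinnedChain ω₂ lam β γ).gibbsMeasure N T|
        = |((∫ x, G x ∂μ) - 0 - δ * ∫ x, G x * h x ∂(pinnedChain ω₂ lam β γ).gibbsMeasure N T) +
            γ * (δ / 2) * ((∫ x, D x ∂μ) - (∫ x, D x ∂(pinnedChain ω₂ lam β γ).gibbsMeasure N T) -
              δ * ∫ x, D x * h x ∂(pinnedChain ω₂ lam β γ).gibbsMeasure N T) +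
            γ * (δ ^ 2 / 2) * ∫ x, D x * h x ∂(pinnedChain ω₂ lam β γ).gibbsMeasure N T| := by
          rw [← abs_neg]; congr 1; ring
      _ ≤ |(∫ x, G x ∂μ) - 0 - δ * ∫ x, G x * h x ∂(pinnedChain ω₂ lam β γ).gibbsMeasure N T| +
            |γ * (δ / 2) * ((∫ x, D x ∂μ) - (∫ x, D x ∂(pinnedChain ω₂ lam β γ).gibbsMeasure N T) -
              δ * ∫ x, D x * h x ∂(pinnedChain ω₂ lam β γ).gibbsMeasure N T)| +
            |γ * (δ ^ 2 / 2) * ∫ x, D x * h x ∂(pinnedChain ω₂ lam β γ).gibbsMeasure N T| :=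
          abs_add_three _ _ _
      _ = |(∫ x, G x ∂μ) - 0 - δ * ∫ x, G x * h x ∂(pinnedChain ω₂ lam β γ).gibbsMeasure N T| +
            γ * (δ / 2) * |(∫ x, D x ∂μ) - (∫ x, D x ∂(pinnedChain ω₂ lam β γ).gibbsMeasure N T) -
              δ * ∫ x, D x * h x ∂(pinnedChain ω₂ lam β γ).gibbsMeasure N T| +
            γ * (δ ^ 2 / 2) * |∫ x, D x * h x ∂(pinnedChain ω₂ lam β γ).gibbsMeasure N T| := by
          rw [abs_mul (γ * (δ / 2)), abs_mul (γ * (δ ^ 2 / 2)), abs_of_pos hc1, abs_of_pos hc2]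
      _ ≤ δ * ε' + γ * (δ / 2) * (δ * ε') +
            γ * (δ ^ 2 / 2) * |∫ x, D x * h x ∂(pinnedChain ω₂ lam β γ).gibbsMeasure N T| := by
          gcongr
  -- absorb: `γ(δ/2)(δε') ≤ γ(δ/2)ε'` (`δ ≤ 1`) and `γ(δ²/2)|Y| = γ(δ/2)(δ|Y|) ≤ γ(δ/2)ε'`
  have t1 : γ * (δ / 2) * (δ * ε') ≤ γ * (δ / 2) * ε' :=
    mul_le_mul_of_nonneg_left (mul_le_of_le_one_left hε'pos.le hδone) (by positivity)
  have t2 : γ * (δ ^ 2 / 2) * |∫ x, D x * h x ∂(pinnedChain ω₂ lam β γ).gibbsMeasure N T| =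
      γ * (δ / 2) * (δ * |∫ x, D x * h x ∂(pinnedChain ω₂ lam β γ).gibbsMeasure N T|) := by ring
  have t3 : γ * (δ / 2) * (δ * |∫ x, D x * h x ∂(pinnedChain ω₂ lam β γ).gibbsMeasure N T|) ≤
      γ * (δ / 2) * ε' := mul_le_mul_of_nonneg_left hδY' (by positivity)
  have t4 : δ * ε = δ * ε' + γ * (δ / 2) * ε' * 2 := by rw [← hεε']; ring
  have e3 : δ * |(∫ x, G x * h x ∂(pinnedChain ω₂ lam β γ).gibbsMeasure N T) +
        γ / 2 * ∫ x, D x ∂(pinnedChain ω₂ lam β γ).gibbsMeasure N T| ≤ δ * ε := by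
    linarith [e2, t1, t2, t3, t4]
  exact le_of_mul_le_mul_left e3 hδ

/-- **[WL] — the weak linearised steady-state equation, source form.** For the pinned anharmonic chain (`ω₂, lam, β, γ, T > 0`,
`N ≥ 1`), every response density `h` (`IsResponseDensityAt ω₂ lam β γ T N h`) and every `F ∈ C_c^∞`:
`∫ (L_{T,T}F)·h dμ₀ = −(γ/(2T²))·∫ (p_0² − p²_{N−1})·F dμ₀`, `μ₀ = gibbsMeasure N T` — i.e. `L_{T,T}^† h = −(γ/2T²)(p_0² − p²_{N−1})` weakly. -/
theorem integral_generator_mul_responseDensity_eq (hω : 0 < ω₂) (hl : 0 < lam) (hβ : 0 < β)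
    (hγ : 0 < γ) {T : ℝ} (hT : 0 < T) (hN : 1 ≤ N) {h : PhaseSpace N → ℝ}
    (hh : IsResponseDensityAt ω₂ lam β γ T N h) {F : PhaseSpace N → ℝ}
    (hF : ContDiff ℝ ((⊤ : ℕ∞) : WithTop ℕ∞) F) (hFc : HasCompactSupport F) :
    ∫ x, (pinnedChain ω₂ lam β γ).generator N T T F x * h x
        ∂(pinnedChain ω₂ lam β γ).gibbsMeasure N T =
      -(γ / (2 * T ^ 2)) * ∫ x, (x.2 ⟨0, by omega⟩ ^ 2 - x.2 ⟨N - 1, by omega⟩ ^ 2) * F x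
        ∂(pinnedChain ω₂ lam β γ).gibbsMeasure N T := by
  have htop1 : ((⊤ : ℕ∞) : WithTop ℕ∞) + 1 ≤ ((⊤ : ℕ∞) : WithTop ℕ∞) := by exact_mod_cast le_top
  have htop2 : ((⊤ : ℕ∞) : WithTop ℕ∞) + 2 ≤ ((⊤ : ℕ∞) : WithTop ℕ∞) :=
    calc ((⊤ : ℕ∞) : WithTop ℕ∞) + 2 = (⊤ : ℕ∞) + 1 + 1 := by rw [add_assoc, one_add_one_eq_two]
      _ ≤ (⊤ : ℕ∞) + 1 := add_le_add_right htop1 1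
      _ ≤ (⊤ : ℕ∞) := htop1
  have h1top : (1 : WithTop ℕ∞) ≤ ((⊤ : ℕ∞) : WithTop ℕ∞) := by exact_mod_cast le_top
  have h2top : (2 : WithTop ℕ∞) ≤ ((⊤ : ℕ∞) : WithTop ℕ∞) := le_trans le_add_self htop2
  have h0top : ((⊤ : ℕ∞) : WithTop ℕ∞) ≠ 0 := (lt_of_lt_of_le zero_lt_one h1top).ne'
  rw [integral_generator_mul_responseDensity_eq_tilt hω hl hβ hγ hT hN hh hF hFc]
  have hFd : Differentiable ℝ F := hF.differentiable h0top
  have hFcont : Continuous F := hF.continuous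
  have hd : ∀ k : Fin N, ContDiff ℝ ((⊤ : ℕ∞) : WithTop ℕ∞) (partialP k F) := fun k =>
    contDiff_partialP hF htop1 k
  have hdc : ∀ k : Fin N, HasCompactSupport (partialP k F) := fun k =>
    hasCompactSupport_partialP hFd hFc k
  have ht : IsTempered ω₂ lam β γ N F := IsTempered.of_hasCompactSupport hFcont hFc
  have ht' : ∀ k : Fin N, IsTempered ω₂ lam β γ N (partialP k F) := fun k =>
    IsTempered.of_hasCompactSupport (hd k).continuous (hdc k)
  have ht'' : ∀ k : Fin N, IsTempered ω₂ lam β γ N (partialP k (partialP k F)) := fun k =>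
    IsTempered.of_hasCompactSupport (contDiff_partialP (hd k) htop1 k).continuous
      (hasCompactSupport_partialP ((hd k).differentiable h0top) (hdc k) k)
  rw [integral_partialP_partialP_gibbsMeasure_eq hω hl.le hβ.le γ hT _ (hF.of_le h2top) ht (ht' _) (ht'' _),
    integral_partialP_partialP_gibbsMeasure_eq hω hl.le hβ.le γ hT _ (hF.of_le h2top) ht (ht' _) (ht'' _)]
  haveI hμ₀P : IsProbabilityMeasure ((pinnedChain ω₂ lam β γ).gibbsMeasure N T) :=
    pinnedChain_isProbabilityMeasure_gibbsMeasure hω hl.le hβ.le γ N hT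
  have hi : ∀ k : Fin N, Integrable (fun x : PhaseSpace N => x.2 k ^ 2 * F x)
      ((pinnedChain ω₂ lam β γ).gibbsMeasure N T) := fun k =>
    ((((continuous_apply k).comp continuous_snd).pow 2).mul hFcont).integrable_of_hasCompactSupport
      hFc.mul_left
  have hsplit : ∫ x, (x.2 ⟨0, by omega⟩ ^ 2 - x.2 ⟨N - 1, by omega⟩ ^ 2) * F x
        ∂(pinnedChain ω₂ lam β γ).gibbsMeasure N T =
      (∫ x, x.2 ⟨0, by omega⟩ ^ 2 * F x ∂(pinnedChain ω₂ lam β γ).gibbsMeasure N T) -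
        ∫ x, x.2 ⟨N - 1, by omega⟩ ^ 2 * F x ∂(pinnedChain ω₂ lam β γ).gibbsMeasure N T := by
    rw [← integral_sub (hi _) (hi _)]
    refine integral_congr_ae (Filter.Eventually.of_forall fun x => ?_)
    ring
  rw [hsplit]
  have hT2 : T ^ 2 ≠ 0 := by positivity
  field_simp
  ring

end EscapeGrading

end Summit.AtomisticToContinuum.FouriersLaw.Theorems.SubdiffusiveBondHeat
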